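import Summits.Ventures.LatticeQCDFlow.Scaling.SectorExactLabelChain
import Summits.Ventures.LatticeQCDFlow.Scaling.SectorExactStaleSet

/-!
HONEST FRAMING: exact (Metropolis-corrected) sampling algorithms for lattice gauge theory; figures
of merit are autocorrelation/cost numbers at stated couplings and volumes; no continuum-physics
claim.

# SectorExactColdStartLaw — OPEN-MATH ITEM 1 FOR SECTOR-EXACT TRANSPORT ON A GENERAL STATE SPACE: IF THE FLOW IS EXACT WITHIN EACH
# SECTOR OF A PARTITION `ℓ : S → L` AND ONLY THE SECTOR WEIGHTS ARE OFF, THE PERSISTENT MAP-ASSISTED HUB WITH EXACT HOT REDRAWS AND SECTOR-CONFINED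
# COLD DYNAMICS HAS `‖δ_x Pⁿ − π̃‖ ≤ P{D_n ≠ ∅} + ‖δ_{ℓx} P_Lⁿ − π̃_L‖` AND `d(n) ≤ ((θ+K)/θ)(1−λ)ⁿ + d_L(n)`: ITEM 1 FOR PARTITION-EXACT FLOWS IS ITEM 1
# FOR THE LABEL STAR (lean-2 GEN-30, ours)

Venture-side (OURS).  Cell `lqcd-flow` (pub-lqcd), unit `pub-lqcd-lean-2-g30`, 2026-08-28.  Chapter Q (item 1 for sector-exact maps on a general
`S`), file 5 — the assembly.  From `δ_{(x,univ)}` the augmented law `λ̂_n` splits into its stale part (`D ≠ ∅`, mass `≤ ((θ+K)/θ)(1−λ)ⁿ`,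
`Scaling/SectorExactStaleSet`) and its born part `λ̂_n(·, ∅)`, which is sector-fresh at EVERY coordinate (`Scaling/SectorFreshness`), hence
proportional to `π̃` on every label class; so `Σ_z |λ̂_n(z,∅) − π̃(z)|` is a sum over LABEL classes, controlled by the label law, which is the
LABEL star's (`Scaling/SectorExactLabelChain`), which for two sectors is chapter P's Boolean star and obeys its volume-free law
(`Scaling/BooleanStarColdStartLaw`, file 6).

## What is proved

* §1 **`sfresh_ratio_const`** — a function sector-fresh at every coordinate is proportional to `π̃` on each label class:
  `λ(z)·π̃(z') = λ(z')·π̃(z)` whenever `ℓ z = ℓ z'` (induction on the number of differing coordinates);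
  **`sfresh_sum_abs_sub_eq`** — then `Σ_z |λ(z) − π̃(z)| = Σ_s |Σ_{ℓz=s} λ(z) − Σ_{ℓz=s} π̃(z)|`.
* §2 **`sectorExact_tvDist_le`** — for every start `x` and time `n`:
  **`‖δ_x Pⁿ − π̃‖_TV ≤ Σ_{D ≠ ∅} λ̂_n + ‖δ_{ℓx} P_Lⁿ − π̃_L‖_TV`** (maps exact on every sector of a partition `ℓ : S → L`, exact hot redraws,
  `μ_k`-stationary sector-confined cold kernels, every sector charged);
  **`sectorExact_worstTvDist_le_labelStar`** — **`d(n) ≤ ((θ+K)/θ)(1−λ)ⁿ + d_L(n)`**: OPEN-MATH item 1 for flows exact on a `q`-cell partition IS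
  item 1 for the `q`-point label star (settled for `q = 2` by chapter P, file 6; open for `q ≥ 3`).

Reading (no numerics implied): the configuration is as far from equilibrium as its primordial content plus its topological labels — and
both are governed by the two-point model.  The rate and the mixing time are read off in file 6.  NOT CLAIMED: maps that are not sector-exact
(the general persistent hub stays open), cold kernels crossing sectors, anything measured.  Literature grade (cell rule): OWN; nothing cited
as a fact; no new bib keys.
-/

noncomputable section

open Finset Function
open Literature.Probability.MarkovChains

namespace Summit.Ventures.LatticeQCDFlow.Scaling

variable {S : Type*} [Fintype S] [DecidableEq S] {K m : ℕ} {μ : Fin (K + 1) → S → ℝ} {M : Fin (K + 1) → S → S → ℝ}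
  {w : Fin (K + 1) → ℝ} {t : ℝ}

section Ratio
variable {L : Type*} [Fintype L] [DecidableEq L] (ℓ : S → L)

/-! ## §1 Sector-fresh at every coordinate ⇒ proportional to `π̃` on label classes -/

omit [Fintype S] [Fintype L] [DecidableEq L] in
/-- **A function sector-fresh at every coordinate is proportional to `π̃` on each label class:** if
`λ(z[j ↦ v])·μ_j(z_j) = λ(z)·μ_j(v)` for all `j` and `v` in the sector of `z_j`, then `λ(z)·π̃(z') = λ(z')·π̃(z)` whenever `z, z'` have the
same labels (`μ > 0`). [ours] -/
theorem sfresh_ratio_const (hμ : ∀ k x, 0 < μ k x) {lam : (Fin (K + 1) → S) → ℝ}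
    (hlam : ∀ (z : Fin (K + 1) → S) (j : Fin (K + 1)) (v : S), ℓ v = ℓ (z j) → lam (update z j v) * μ j (z j) = lam z * μ j v) :
    ∀ (n : ℕ) (z z' : Fin (K + 1) → S), (univ.filter (fun k => z k ≠ z' k)).card ≤ n → (∀ k, ℓ (z k) = ℓ (z' k)) →
      lam z * tensorFun μ z' = lam z' * tensorFun μ z := by
  intro n
  induction n with
  | zero =>
    intro z z' hcard _
    have hzz : z = z' := by
      funext k
      by_contra hk
      have : k ∈ univ.filter (fun k => z k ≠ z' k) := Finset.mem_filter.mpr ⟨mem_univ _, hk⟩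
      rw [Finset.card_eq_zero.mp (Nat.le_zero.mp hcard)] at this
      exact absurd this (Finset.notMem_empty _)
    rw [hzz]
  | succ n ih =>
    intro z z' hcard hlab
    by_cases h0 : (univ.filter (fun k => z k ≠ z' k)).card = 0
    · exact ih z z' (by omega) hlab
    · obtain ⟨k, hk⟩ := Finset.card_pos.mp (Nat.pos_of_ne_zero h0)
      have hkne : z k ≠ z' k := (Finset.mem_filter.mp hk).2
      -- move coordinate `k` of `z` to `z'_k`
      set z'' := update z k (z' k) with hz''
      have hcard'' : (univ.filter (fun j => z'' j ≠ z' j)).card ≤ n := by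
        have hsub : univ.filter (fun j => z'' j ≠ z' j) ⊆ (univ.filter (fun j => z j ≠ z' j)).erase k := by
          intro j hj
          have hj' := (Finset.mem_filter.mp hj).2
          have hjk : j ≠ k := fun h => by rw [h, hz'', update_self] at hj'; exact hj' rfl
          rw [hz'', update_of_ne hjk] at hj'
          exact Finset.mem_erase.mpr ⟨hjk, Finset.mem_filter.mpr ⟨mem_univ _, hj'⟩⟩
        have := Finset.card_le_card hsub
        rw [Finset.card_erase_of_mem hk] at this
        omega
      have hlab'' : ∀ j, ℓ (z'' j) = ℓ (z' j) := by
        intro j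
        by_cases hjk : j = k
        · subst hjk; rw [hz'', update_self]
        · rw [hz'', update_of_ne hjk]; exact hlab j
      have hIH := ih z'' z' hcard'' hlab''
      -- `λ(z'')μ_k(z_k) = λ(z)μ_k(z'_k)` and `π̃(z'')μ_k(z_k) = π̃(z)μ_k(z'_k)`
      have h1 : lam z'' * μ k (z k) = lam z * μ k (z' k) := hlam z k (z' k) (hlab k).symm
      have h2 : tensorFun μ z'' * μ k (z k) = tensorFun μ z * μ k (z' k) := tensorFun_update_mul μ z k (z' k)
      have hμk : 0 < μ k (z k) := hμ _ _
      have hμk' : 0 < μ k (z' k) := hμ _ _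
      -- multiply the induction identity by `μ_k(z_k)²` and substitute
      have key : (lam z * tensorFun μ z') * (μ k (z' k) * μ k (z k)) = (lam z' * tensorFun μ z) * (μ k (z' k) * μ k (z k)) := by
        calc (lam z * tensorFun μ z') * (μ k (z' k) * μ k (z k))
            = (lam z * μ k (z' k)) * tensorFun μ z' * μ k (z k) := by ring
          _ = (lam z'' * μ k (z k)) * tensorFun μ z' * μ k (z k) := by rw [h1]
          _ = (lam z'' * tensorFun μ z') * (μ k (z k) * μ k (z k)) := by ring
          _ = (lam z' * tensorFun μ z'') * (μ k (z k) * μ k (z k)) := by rw [hIH]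
          _ = lam z' * (tensorFun μ z'' * μ k (z k)) * μ k (z k) := by ring
          _ = lam z' * (tensorFun μ z * μ k (z' k)) * μ k (z k) := by rw [h2]
          _ = (lam z' * tensorFun μ z) * (μ k (z' k) * μ k (z k)) := by ring
      exact mul_right_cancel₀ (mul_pos hμk' hμk).ne' key

omit [DecidableEq S] in
/-- **Consequence:** `Σ_z |λ(z) − π̃(z)| = Σ_s |Σ_{ℓ z = s} λ(z) − Σ_{ℓ z = s} π̃(z)|` for a function sector-fresh at every coordinate
(`μ > 0`): the distance to `π̃` is carried by the labels alone. [ours] -/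
theorem sfresh_sum_abs_sub_eq (hμ : ∀ k x, 0 < μ k x) {lam : (Fin (K + 1) → S) → ℝ}
    (hlam : ∀ (z : Fin (K + 1) → S) (j : Fin (K + 1)) (v : S), ℓ v = ℓ (z j) → lam (update z j v) * μ j (z j) = lam z * μ j v) :
    ∑ z, |lam z - tensorFun μ z|
      = ∑ s : Fin (K + 1) → L, |∑ z ∈ univ.filter (fun z : Fin (K + 1) → S => (fun k => ℓ (z k)) = s), lam z
          - ∑ z ∈ univ.filter (fun z : Fin (K + 1) → S => (fun k => ℓ (z k)) = s), tensorFun μ z| := by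
  classical
  have hπ := tensorFun_pos hμ
  rw [← Finset.sum_fiberwise univ (fun z : Fin (K + 1) → S => (fun k => ℓ (z k))) (fun z => |lam z - tensorFun μ z|)]
  refine sum_congr rfl fun s _ => ?_
  set F := univ.filter (fun z : Fin (K + 1) → S => (fun k => ℓ (z k)) = s) with hF
  -- on the class `F`: `λ(z)·π̃(F) = π̃(z)·λ(F)`
  have hprop : ∀ z ∈ F, lam z * ∑ z' ∈ F, tensorFun μ z' = tensorFun μ z * ∑ z' ∈ F, lam z' := by
    intro z hz
    rw [Finset.mul_sum, Finset.mul_sum]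
    refine sum_congr rfl fun z' hz' => ?_
    have hl : ∀ k, ℓ (z k) = ℓ (z' k) := by
      intro k
      have h1 : ℓ (z k) = s k := congrFun (Finset.mem_filter.mp hz).2 k
      have h2 : ℓ (z' k) = s k := congrFun (Finset.mem_filter.mp hz').2 k
      rw [h1, h2]
    rw [sfresh_ratio_const ℓ hμ hlam _ z z' le_rfl hl, mul_comm]
  by_cases hFe : F = ∅
  · rw [hFe]; simp
  · have hπF : 0 < ∑ z' ∈ F, tensorFun μ z' := Finset.sum_pos (fun z _ => hπ z) (Finset.nonempty_iff_ne_empty.mpr hFe)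
    -- `λ(z) = π̃(z)·ρ` with `ρ = λ(F)/π̃(F)`
    have hrat : ∀ z ∈ F, lam z = tensorFun μ z * ((∑ z' ∈ F, lam z') / ∑ z' ∈ F, tensorFun μ z') := by
      intro z hz
      rw [mul_div_assoc', eq_div_iff hπF.ne']
      exact hprop z hz
    calc ∑ z ∈ F, |lam z - tensorFun μ z|
        = ∑ z ∈ F, tensorFun μ z * |(∑ z' ∈ F, lam z') / (∑ z' ∈ F, tensorFun μ z') - 1| := by
          refine sum_congr rfl fun z hz => ?_
          rw [hrat z hz, ← abs_of_pos (hπ z), ← abs_mul, abs_of_pos (hπ z)]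
          congr 1; ring
      _ = (∑ z ∈ F, tensorFun μ z) * |(∑ z' ∈ F, lam z') / (∑ z' ∈ F, tensorFun μ z') - 1| := by rw [Finset.sum_mul]
      _ = |∑ z' ∈ F, lam z' - ∑ z' ∈ F, tensorFun μ z'| := by
          rw [← abs_of_pos hπF, ← abs_mul, abs_of_pos hπF]
          congr 1
          field_simp

end Ratio

section Assembly
variable (κ : Fin m → Fin K) (φ : Fin m → Equiv.Perm S) {L : Type*} [Fintype L] [DecidableEq L] (ℓ : S → L)

/-! ## §2 The total-variation decomposition -/

/-- **`‖δ_x Pⁿ − π̃‖_TV ≤ Σ_{D ≠ ∅} λ̂_n + ‖δ_{ℓx} P_Bⁿ − π̃_B‖_TV`** for the sector-exact scheme from every start. [ours] -/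
theorem sectorExact_tvDist_le (hm : 1 ≤ m) (ht0 : 0 ≤ t) (ht1 : t ≤ 1) (hw0 : ∀ k, 0 ≤ w k) (hw1 : ∑ k, w k = 1)
    (hμ : ∀ k x, 0 < μ k x) (hφℓ : ∀ r u, ℓ (φ r u) = ℓ u) {cL : Fin m → L → ℝ}
    (hcL : ∀ r b, 0 < cL r b) (hexact : ∀ r u, μ (κ r).succ (φ r u) = cL r (ℓ u) * μ 0 u)
    (hM : ∀ k, IsRowStochastic (M k)) (hM0 : ∀ u v, M 0 u v = μ 0 v)
    (hstat : ∀ k : Fin (K + 1), k ≠ 0 → ∀ v, ∑ u, μ k u * M k u v = μ k v)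
    (hconf : ∀ k : Fin (K + 1), k ≠ 0 → ∀ u v, ℓ u ≠ ℓ v → M k u v = 0)
    {μB : Fin (K + 1) → L → ℝ} (hμB : ∀ k b, μB k b = ∑ u ∈ univ.filter (fun u => ℓ u = b), μ k u)
    (hμB0 : ∀ k b, 0 < μB k b)
    {Ph : (Fin (K + 1) → S) × Finset (Fin (K + 1)) → (Fin (K + 1) → S) × Finset (Fin (K + 1)) → ℝ}
    (hPh : ∀ a b, Ph a b = ∑ r : Fin m, t / m *
        ((fun r a => (fun r z => min 1 (tensorFun μ (edgeFlowSwap (φ r) 0 (κ r).succ z) / tensorFun μ z)) r a.1) r a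
            * (if b.1 = edgeFlowSwap (φ r) 0 (κ r).succ a.1
            ∧ b.2 = a.2.image (Equiv.swap (0 : Fin (K + 1)) (κ r).succ) then (1 : ℝ) else 0)
          + ((fun r z => min 1 (tensorFun μ (edgeFlowSwap (φ r) 0 (κ r).succ z) / tensorFun μ z)) r a.1
              - (fun r a => (fun r z => min 1 (tensorFun μ (edgeFlowSwap (φ r) 0 (κ r).succ z) / tensorFun μ z)) r a.1) r a)
            * (if b.1 = edgeFlowSwap (φ r) 0 (κ r).succ a.1
              ∧ b.2 = (fun (_ : Fin m) (D : Finset (Fin (K + 1))) => D) r a.2 then (1 : ℝ) else 0)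
          + (1 - (fun r z => min 1 (tensorFun μ (edgeFlowSwap (φ r) 0 (κ r).succ z) / tensorFun μ z)) r a.1)
            * (if b.1 = a.1 ∧ b.2 = (fun (_ : Fin m) (D : Finset (Fin (K + 1))) => D) r a.2 then (1 : ℝ) else 0))
      + (1 - t) * ∑ k : Fin (K + 1), w k * (coordKernel M k a.1 b.1
          * (if b.2 = (if k = 0 then a.2.erase 0 else a.2) then (1 : ℝ) else 0)))
    (x : Fin (K + 1) → S) (n : ℕ) :
    tvDist (lawAt (fun y z : Fin (K + 1) → S =>
        t * ptGraphSwap μ (fun r : Fin m => (((0 : Fin (K + 1)), (κ r).succ) : Fin (K + 1) × Fin (K + 1))) φ y z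
          + (1 - t) * prodKernel w M y z) (Pi.single x 1) n) (tensorFun μ)
      ≤ ∑ b ∈ univ.filter (fun b : (Fin (K + 1) → S) × Finset (Fin (K + 1)) => b.2 ≠ ∅),
            lawAt Ph (Pi.single (x, (univ : Finset (Fin (K + 1)))) 1) n b
        + tvDist (lawAt (fun y s : Fin (K + 1) → L =>
            t * ptGraphSwap μB (fun r : Fin m => (((0 : Fin (K + 1)), (κ r).succ) : Fin (K + 1) × Fin (K + 1)))
                (fun _ : Fin m => Equiv.refl L) y s
              + (1 - t) * prodKernel w (fun (k : Fin (K + 1)) (u v : L) => if k = 0 then μB 0 v else (if u = v then (1 : ℝ) else 0)) y s)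
            (Pi.single (fun k => ℓ (x k)) 1) n) (tensorFun μB) := by
  set lamh := lawAt Ph (Pi.single (x, (univ : Finset (Fin (K + 1)))) 1) n with hlamh
  have hαrfl : ∀ r z, (fun r z => min 1 (tensorFun μ (edgeFlowSwap (φ r) 0 (κ r).succ z) / tensorFun μ z)) r z
      = min 1 (tensorFun μ (edgeFlowSwap (φ r) 0 (κ r).succ z) / tensorFun μ z) := fun _ _ => rfl
  have hPs := sectorAug_isRowStochastic κ φ hm ht0 ht1 hw0 hw1 hM hμ hαrfl hPh
  have hL0 : ∀ b, 0 ≤ lamh b := fun b => lawAt_nonneg hPs (fun a => by rw [Pi.single_apply]; split_ifs <;> norm_num) n b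
  -- (1) the configuration law is the tag marginal
  have hfst : ∀ z, lawAt (fun y z : Fin (K + 1) → S =>
      t * ptGraphSwap μ (fun r : Fin m => (((0 : Fin (K + 1)), (κ r).succ) : Fin (K + 1) × Fin (K + 1))) φ y z
        + (1 - t) * prodKernel w M y z) (Pi.single x 1) n z = ∑ D, lamh (z, D) :=
    fun z => (sectorAug_lawAt_fst κ φ hm hμ hαrfl hPh x n z).symm
  -- (2) the born part is sector-fresh at every coordinate
  have hfresh : ∀ (z : Fin (K + 1) → S) (j : Fin (K + 1)) (v : S), ℓ v = ℓ (z j) →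
      lamh (update z j v, ∅) * μ j (z j) = lamh (z, ∅) * μ j v :=
    fun z j v hv => sector_fresh_lawAt κ φ ℓ hμ hφℓ hcL hexact hM0 hstat hconf hαrfl hPh x n z ∅ j v
      (Finset.notMem_empty j) hv
  -- (3) the label law is the Boolean star's
  have hlab := sectorExact_label_lawAt κ φ ℓ (w := w) (t := t) hm hμ hφℓ hcL hexact hM hM0 hconf hμB hμB0 x n
  -- the decomposition
  have hsplit : ∀ z, ∑ D, lamh (z, D) = lamh (z, ∅) + ∑ D ∈ univ.erase ∅, lamh (z, D) := fun z =>
    (Finset.add_sum_erase univ (fun D => lamh (z, D)) (mem_univ ∅)).symm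
  have hstale : ∑ z : Fin (K + 1) → S, ∑ D ∈ univ.erase ∅, lamh (z, D)
      = ∑ b ∈ univ.filter (fun b : (Fin (K + 1) → S) × Finset (Fin (K + 1)) => b.2 ≠ ∅), lamh b := by
    rw [Finset.sum_filter, Fintype.sum_prod_type]
    refine sum_congr rfl fun z _ => ?_
    rw [← Finset.sum_erase_add univ _ (mem_univ ∅), if_neg (fun h => h rfl), add_zero]
    exact Finset.sum_congr rfl fun D hD => by rw [if_pos (Finset.ne_of_mem_erase hD)]
  -- `Σ_z |λ̂(z,∅) − π̃(z)|` through the labels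
  have hborn : ∑ z, |lamh (z, ∅) - tensorFun μ z|
      = ∑ s : Fin (K + 1) → L, |∑ z ∈ univ.filter (fun z : Fin (K + 1) → S => (fun k => ℓ (z k)) = s), lamh (z, ∅)
          - ∑ z ∈ univ.filter (fun z : Fin (K + 1) → S => (fun k => ℓ (z k)) = s), tensorFun μ z| :=
    sfresh_sum_abs_sub_eq ℓ hμ (lam := fun z => lamh (z, ∅)) hfresh
  have hbornle : ∑ s : Fin (K + 1) → L, |∑ z ∈ univ.filter (fun z : Fin (K + 1) → S => (fun k => ℓ (z k)) = s), lamh (z, ∅)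
          - ∑ z ∈ univ.filter (fun z : Fin (K + 1) → S => (fun k => ℓ (z k)) = s), tensorFun μ z|
      ≤ ∑ s : Fin (K + 1) → L, |∑ z ∈ univ.filter (fun z : Fin (K + 1) → S => (fun k => ℓ (z k)) = s), ∑ D, lamh (z, D)
          - tensorFun μB s|
        + ∑ z : Fin (K + 1) → S, ∑ D ∈ univ.erase ∅, lamh (z, D) := by
    rw [← Finset.sum_fiberwise univ (fun z : Fin (K + 1) → S => (fun k => ℓ (z k)))
      (fun z => ∑ D ∈ univ.erase ∅, lamh (z, D)), ← Finset.sum_add_distrib]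
    refine sum_le_sum fun s _ => ?_
    rw [sectorExact_label_tensorFun ℓ hμB s]
    have hsum : ∑ z ∈ univ.filter (fun z : Fin (K + 1) → S => (fun k => ℓ (z k)) = s), ∑ D, lamh (z, D)
        = ∑ z ∈ univ.filter (fun z : Fin (K + 1) → S => (fun k => ℓ (z k)) = s), lamh (z, ∅)
          + ∑ z ∈ univ.filter (fun z : Fin (K + 1) → S => (fun k => ℓ (z k)) = s), ∑ D ∈ univ.erase ∅, lamh (z, D) := by
      rw [← Finset.sum_add_distrib]; exact sum_congr rfl fun z _ => hsplit z
    rw [hsum]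
    have hnn : 0 ≤ ∑ z ∈ univ.filter (fun z : Fin (K + 1) → S => (fun k => ℓ (z k)) = s), ∑ D ∈ univ.erase ∅, lamh (z, D) :=
      sum_nonneg fun z _ => sum_nonneg fun D _ => hL0 _
    have := abs_sub_abs_le_abs_sub
      (∑ z ∈ univ.filter (fun z : Fin (K + 1) → S => (fun k => ℓ (z k)) = s), lamh (z, ∅) - tensorFun μB s)
      (∑ z ∈ univ.filter (fun z : Fin (K + 1) → S => (fun k => ℓ (z k)) = s), lamh (z, ∅)
        + ∑ z ∈ univ.filter (fun z : Fin (K + 1) → S => (fun k => ℓ (z k)) = s), ∑ D ∈ univ.erase ∅, lamh (z, D)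
        - tensorFun μB s)
    rw [show (∑ z ∈ univ.filter (fun z : Fin (K + 1) → S => (fun k => ℓ (z k)) = s), lamh (z, ∅) - tensorFun μB s)
      - (∑ z ∈ univ.filter (fun z : Fin (K + 1) → S => (fun k => ℓ (z k)) = s), lamh (z, ∅)
        + ∑ z ∈ univ.filter (fun z : Fin (K + 1) → S => (fun k => ℓ (z k)) = s), ∑ D ∈ univ.erase ∅, lamh (z, D)
        - tensorFun μB s)
      = -(∑ z ∈ univ.filter (fun z : Fin (K + 1) → S => (fun k => ℓ (z k)) = s), ∑ D ∈ univ.erase ∅, lamh (z, D)) by ring,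
      abs_neg, abs_of_nonneg hnn] at this
    linarith
  -- assemble
  have hcfg : ∑ z, |lawAt (fun y z : Fin (K + 1) → S =>
        t * ptGraphSwap μ (fun r : Fin m => (((0 : Fin (K + 1)), (κ r).succ) : Fin (K + 1) × Fin (K + 1))) φ y z
          + (1 - t) * prodKernel w M y z) (Pi.single x 1) n z - tensorFun μ z|
      = ∑ z : Fin (K + 1) → S, |lamh (z, ∅) + ∑ D ∈ univ.erase ∅, lamh (z, D) - tensorFun μ z| :=
    sum_congr rfl fun z _ => by rw [hfst z, hsplit z]
  have hlabel : ∑ s, |lawAt (fun y s : Fin (K + 1) → L =>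
            t * ptGraphSwap μB (fun r : Fin m => (((0 : Fin (K + 1)), (κ r).succ) : Fin (K + 1) × Fin (K + 1)))
                (fun _ : Fin m => Equiv.refl L) y s
              + (1 - t) * prodKernel w (fun (k : Fin (K + 1)) (u v : L) => if k = 0 then μB 0 v else (if u = v then (1 : ℝ) else 0)) y s)
            (Pi.single (fun k => ℓ (x k)) 1) n s - tensorFun μB s|
      = ∑ s : Fin (K + 1) → L, |∑ z ∈ univ.filter (fun z : Fin (K + 1) → S => (fun k => ℓ (z k)) = s), ∑ D, lamh (z, D)
          - tensorFun μB s| :=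
    sum_congr rfl fun s _ => by rw [← hlab s, Finset.sum_congr rfl fun z _ => hfst z]
  unfold tvDist
  rw [hcfg, hlabel]
  have htri : ∑ z : Fin (K + 1) → S, |lamh (z, ∅) + ∑ D ∈ univ.erase ∅, lamh (z, D) - tensorFun μ z|
      ≤ ∑ z : Fin (K + 1) → S, ∑ D ∈ univ.erase ∅, lamh (z, D) + ∑ z, |lamh (z, ∅) - tensorFun μ z| := by
    rw [← Finset.sum_add_distrib]
    refine sum_le_sum fun z _ => ?_
    have hnn : 0 ≤ ∑ D ∈ univ.erase ∅, lamh (z, D) := sum_nonneg fun D _ => hL0 _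
    calc |lamh (z, ∅) + ∑ D ∈ univ.erase ∅, lamh (z, D) - tensorFun μ z|
        = |∑ D ∈ univ.erase ∅, lamh (z, D) + (lamh (z, ∅) - tensorFun μ z)| := by ring_nf
      _ ≤ |∑ D ∈ univ.erase ∅, lamh (z, D)| + |lamh (z, ∅) - tensorFun μ z| := abs_add_le _ _
      _ = _ := by rw [abs_of_nonneg hnn]
  rw [hborn] at htri
  rw [hstale] at htri hbornle
  linarith [htri, hbornle]


/-- **THE REDUCTION TO THE LABEL STAR (any number of sectors):** for maps exact on every sector of a partition `ℓ : S → L` (labels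
preserved, `μ_l(φ_r u) = c_r(ℓ u)μ_0(u)`), exact hot redraws and `μ_k`-stationary sector-confined cold kernels, with acceptance floor
`a ≤ min{1, c_r(b)/c_r(b')}`, `0 < θ ≤ 1`, `(1−θ)t ≤ (1−t)w_0θ`, hub multiplicities `≥ c`:
**`d(n) ≤ ((θ+K)/θ)·(1 − min{(1−θ)act/m, ((1−t)w_0θ − (1−θ)t)/(K+θ)})ⁿ + d_L(n)`**, where `d_L` is the worst-case distance of the LABEL STAR on
`L` (laws `μ_k(ℓ = ·)`, identity maps, exact hot redraw, idle cold labels).  OPEN-MATH item 1 for partition-exact flows with `q` sectors IS item 1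
for the `q`-point star. [ours] -/
theorem sectorExact_worstTvDist_le_labelStar (hm : 1 ≤ m) (ht0 : 0 ≤ t) (ht1 : t ≤ 1) (hw0 : ∀ k, 0 ≤ w k) (hw1 : ∑ k, w k = 1)
    (hμ : ∀ k x, 0 < μ k x) (hφℓ : ∀ r u, ℓ (φ r u) = ℓ u) {cL : Fin m → L → ℝ}
    (hcL : ∀ r b, 0 < cL r b) (hexact : ∀ r u, μ (κ r).succ (φ r u) = cL r (ℓ u) * μ 0 u)
    (hM : ∀ k, IsRowStochastic (M k)) (hM0 : ∀ u v, M 0 u v = μ 0 v)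
    (hstat : ∀ k : Fin (K + 1), k ≠ 0 → ∀ v, ∑ u, μ k u * M k u v = μ k v)
    (hconf : ∀ k : Fin (K + 1), k ≠ 0 → ∀ u v, ℓ u ≠ ℓ v → M k u v = 0)
    {μB : Fin (K + 1) → L → ℝ} (hμB : ∀ k b, μB k b = ∑ u ∈ univ.filter (fun u => ℓ u = b), μ k u)
    (hμB0 : ∀ k b, 0 < μB k b) {a θ : ℝ} (ha0 : 0 ≤ a) (ha : ∀ r b b', a ≤ min 1 (cL r b / cL r b')) (hθ0 : 0 < θ) (hθ1 : θ ≤ 1)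
    (hreg : (1 - θ) * t ≤ (1 - t) * w 0 * θ) {c : ℕ} (hc : ∀ p' : Fin K, c ≤ (univ.filter (fun r : Fin m => κ r = p')).card) (n : ℕ) :
    worstTvDist (fun y z : Fin (K + 1) → S =>
        t * ptGraphSwap μ (fun r : Fin m => (((0 : Fin (K + 1)), (κ r).succ) : Fin (K + 1) × Fin (K + 1))) φ y z
          + (1 - t) * prodKernel w M y z) (tensorFun μ) n
      ≤ (θ + K) / θ * (1 - min ((1 - θ) * a * c * t / m) (((1 - t) * w 0 * θ - (1 - θ) * t) / (K + θ))) ^ n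
        + worstTvDist (fun y s : Fin (K + 1) → L =>
            t * ptGraphSwap μB (fun r : Fin m => (((0 : Fin (K + 1)), (κ r).succ) : Fin (K + 1) × Fin (K + 1)))
                (fun _ : Fin m => Equiv.refl L) y s
              + (1 - t) * prodKernel w (fun (k : Fin (K + 1)) (u v : L) => if k = 0 then μB 0 v else (if u = v then (1 : ℝ) else 0)) y s)
          (tensorFun μB) n := by
  have hαrfl : ∀ r z, (fun r z => min 1 (tensorFun μ (edgeFlowSwap (φ r) 0 (κ r).succ z) / tensorFun μ z)) r z
      = min 1 (tensorFun μ (edgeFlowSwap (φ r) 0 (κ r).succ z) / tensorFun μ z) := fun _ _ => rfl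
  have haα : ∀ r z, a ≤ (fun r z => min 1 (tensorFun μ (edgeFlowSwap (φ r) 0 (κ r).succ z) / tensorFun μ z)) r z :=
    fun r z => sectorExact_accept_ge κ φ ℓ hμ hφℓ hcL hexact hαrfl ha r z
  have hnonneg : 0 ≤ (θ + K) / θ * (1 - min ((1 - θ) * a * c * t / m) (((1 - t) * w 0 * θ - (1 - θ) * t) / (K + θ))) ^ n
      + worstTvDist (fun y s : Fin (K + 1) → L =>
            t * ptGraphSwap μB (fun r : Fin m => (((0 : Fin (K + 1)), (κ r).succ) : Fin (K + 1) × Fin (K + 1)))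
                (fun _ : Fin m => Equiv.refl L) y s
              + (1 - t) * prodKernel w (fun (k : Fin (K + 1)) (u v : L) => if k = 0 then μB 0 v else (if u = v then (1 : ℝ) else 0)) y s)
          (tensorFun μB) n := by
    have hlam1 : 0 ≤ 1 - min ((1 - θ) * a * c * t / m) (((1 - t) * w 0 * θ - (1 - θ) * t) / (K + θ)) := by
      have h2 : min ((1 - θ) * a * c * t / m) (((1 - t) * w 0 * θ - (1 - θ) * t) / (K + θ))
          ≤ ((1 - t) * w 0 * θ - (1 - θ) * t) / (K + θ) := min_le_right _ _
      have h3 : ((1 - t) * w 0 * θ - (1 - θ) * t) / (K + θ) ≤ 1 := by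
        rw [div_le_one (by positivity)]
        have hw01 : w 0 ≤ 1 := by
          calc w 0 ≤ ∑ k, w k := Finset.single_le_sum (fun k _ => hw0 k) (mem_univ 0)
            _ = 1 := hw1
        nlinarith [mul_nonneg (sub_nonneg.mpr ht1) (hw0 0), mul_nonneg (sub_nonneg.mpr hθ1) ht0, hθ0.le,
          mul_le_mul_of_nonneg_left hw01 (sub_nonneg.mpr ht1), Nat.cast_nonneg (α := ℝ) K]
      linarith
    exact add_nonneg (mul_nonneg (by positivity) (pow_nonneg hlam1 n)) (worstTvDist_nonneg _ _ n)
  refine Real.iSup_le (fun x => ?_) hnonneg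
  have hdec := sectorExact_tvDist_le κ φ ℓ hm ht0 ht1 hw0 hw1 hμ hφℓ hcL hexact hM hM0 hstat hconf hμB hμB0
    (Ph := fun a b => ∑ r : Fin m, t / m *
        ((fun r a => (fun r z => min 1 (tensorFun μ (edgeFlowSwap (φ r) 0 (κ r).succ z) / tensorFun μ z)) r a.1) r a
            * (if b.1 = edgeFlowSwap (φ r) 0 (κ r).succ a.1
            ∧ b.2 = a.2.image (Equiv.swap (0 : Fin (K + 1)) (κ r).succ) then (1 : ℝ) else 0)
          + ((fun r z => min 1 (tensorFun μ (edgeFlowSwap (φ r) 0 (κ r).succ z) / tensorFun μ z)) r a.1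
              - (fun r a => (fun r z => min 1 (tensorFun μ (edgeFlowSwap (φ r) 0 (κ r).succ z) / tensorFun μ z)) r a.1) r a)
            * (if b.1 = edgeFlowSwap (φ r) 0 (κ r).succ a.1
              ∧ b.2 = (fun (_ : Fin m) (D : Finset (Fin (K + 1))) => D) r a.2 then (1 : ℝ) else 0)
          + (1 - (fun r z => min 1 (tensorFun μ (edgeFlowSwap (φ r) 0 (κ r).succ z) / tensorFun μ z)) r a.1)
            * (if b.1 = a.1 ∧ b.2 = (fun (_ : Fin m) (D : Finset (Fin (K + 1))) => D) r a.2 then (1 : ℝ) else 0))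
      + (1 - t) * ∑ k : Fin (K + 1), w k * (coordKernel M k a.1 b.1
          * (if b.2 = (if k = 0 then a.2.erase 0 else a.2) then (1 : ℝ) else 0)))
    (fun _ _ => rfl) x n
  have hstale := sectorAug_stale_le κ φ hm ht0 ht1 hw0 hw1 hM hμ hαrfl ha0 haα hθ0 hθ1 hreg hc
    (Ph := fun a b => ∑ r : Fin m, t / m *
        ((fun r a => (fun r z => min 1 (tensorFun μ (edgeFlowSwap (φ r) 0 (κ r).succ z) / tensorFun μ z)) r a.1) r a
            * (if b.1 = edgeFlowSwap (φ r) 0 (κ r).succ a.1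
            ∧ b.2 = a.2.image (Equiv.swap (0 : Fin (K + 1)) (κ r).succ) then (1 : ℝ) else 0)
          + ((fun r z => min 1 (tensorFun μ (edgeFlowSwap (φ r) 0 (κ r).succ z) / tensorFun μ z)) r a.1
              - (fun r a => (fun r z => min 1 (tensorFun μ (edgeFlowSwap (φ r) 0 (κ r).succ z) / tensorFun μ z)) r a.1) r a)
            * (if b.1 = edgeFlowSwap (φ r) 0 (κ r).succ a.1
              ∧ b.2 = (fun (_ : Fin m) (D : Finset (Fin (K + 1))) => D) r a.2 then (1 : ℝ) else 0)
          + (1 - (fun r z => min 1 (tensorFun μ (edgeFlowSwap (φ r) 0 (κ r).succ z) / tensorFun μ z)) r a.1)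
            * (if b.1 = a.1 ∧ b.2 = (fun (_ : Fin m) (D : Finset (Fin (K + 1))) => D) r a.2 then (1 : ℝ) else 0))
      + (1 - t) * ∑ k : Fin (K + 1), w k * (coordKernel M k a.1 b.1
          * (if b.2 = (if k = 0 then a.2.erase 0 else a.2) then (1 : ℝ) else 0)))
    (fun _ _ => rfl) x n
  have hlabel := tvDist_single_le_worstTvDist (fun y s : Fin (K + 1) → L =>
            t * ptGraphSwap μB (fun r : Fin m => (((0 : Fin (K + 1)), (κ r).succ) : Fin (K + 1) × Fin (K + 1)))
                (fun _ : Fin m => Equiv.refl L) y s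
              + (1 - t) * prodKernel w (fun (k : Fin (K + 1)) (u v : L) => if k = 0 then μB 0 v else (if u = v then (1 : ℝ) else 0)) y s)
    (tensorFun μB) n (fun k => ℓ (x k))
  linarith [hdec, hstale, hlabel]

end Assembly

end Summit.Ventures.LatticeQCDFlow.Scaling

end
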